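import Summits.ResolutionOfSingularities.ResolutionOfSingularities.Theorems.TeissierJungDefs
import Summits.ResolutionOfSingularities.ResolutionOfSingularities.Theorems.TeissierJungTeissierReductionJungTransfer
import HarnessLib

/-!
# Crux `TeissierReduction` (stmt-ResolutionOfSingularities-17085, route `TeissierJung`), line `Sketch`,
# stub `stub_jungTransfer`: Jung's reduction with only the base modified implies the crux

`TeissierReductionJung` (`Theorems/TeissierJungDefs.lean`: a finite surjective projection
`π₀ : H → ℙ^d`, a proper birational `σ : S → ℙ^d`, and the fibre product `H ×_{ℙ^d} S → S`
Teissier-presented OVER `S`) implies `TeissierReduction` (SOME proper birational `X' → H` with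
`TF X'`): take `X' := H ×_{ℙ^d} S` with `pullback.fst : X' → H`, proper as a base change of `σ` and
birational because `π₀` is dominant (it is surjective) and the fibre product is integral — this is the
landed backbone `teissierReduction_of_jungSquares` (p158903) fed with the Jung data. This is the transfer
stub `C⁺ → C` of every Jung-type line of the crux chain; it moves none of the open content.
-/

-- single-problem summit: the doubled namespace component `ResolutionOfSingularities` is forced
set_option linter.dupNamespace false

noncomputable section

open CategoryTheory CategoryTheory.Limits AlgebraicGeometry TopologicalSpace
open Literature.AlgebraicGeometry.Resolution
open Literature.AlgebraicGeometry.Motives (projectiveSpace)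
open Summit.ResolutionOfSingularities.ResolutionOfSingularities.Theses.TeissierJung

namespace Summit.ResolutionOfSingularities.ResolutionOfSingularities.Theorems.TeissierReduction

/-- **Jung transfer.** `TeissierReductionJung → TeissierReduction`: the Jung square of
`TeissierReductionJung` is a witness for `teissierReduction_of_jungSquares` (the finite surjective
`π₀` is dominant; `TeissierPresentedOver` records integrality of the fibre product and forgets to
`TeissierPresented`). [folklore] -/
theorem stub_jungTransfer : TeissierReductionJung → TeissierReduction := by
  intro hJ
  refine teissierReduction_of_jungSquares fun p hp k _ _ _ m H ι' hι hH hpr => ?_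
  obtain ⟨d, π₀, S, σ, _, hsurj, hσp, hσb, hT⟩ := hJ p hp k m H ι' hι hH hpr
  exact ⟨(projectiveSpace d k).left, S, π₀, σ, ⟨hsurj.denseRange⟩, hσp, hσb, hT.isIntegral,
    hT.teissierPresented⟩

end Summit.ResolutionOfSingularities.ResolutionOfSingularities.Theorems.TeissierReduction

end
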